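import Literature.NumberTheory.ComplexMultiplication.ReflexNorm
import Literature.NumberTheory.ComplexMultiplication.TypeNorm
import Literature.NumberTheory.ComplexMultiplication.InducedCMType
import HarnessLib

/-!
# The reflex norm composed with a relative norm is the type norm of the induced reflex type

Shimura, *Abelian Varieties with Complex Multiplication and Modular Functions* (1998) [Shimura1998], §18.5 (18.5b):
the reflex norm `g : (K*)^× → K^×`, `g(a) = ∏_μ a^{τ_μ}` of a CM type `(K, Φ)` with reflex `(K*, Φ*)` (tree:
`reflexNormHom`, `Literature.NumberTheory.ComplexMultiplication.ReflexNorm`); Streng, *Complex multiplication of abelian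
surfaces* (2010) [Streng2010], Ch. I Def. 3.2 / Lemma 3.3: for a finite extension `M ⊇ K*` the type INDUCED from
`Φ*` is `Φ*_M = {θ : M → ℂ | θ|_{K*} ∈ Φ*}` and its type norm is `N_{Φ*_M} = N_{Φ*} ∘ N_{M/K*}` (tree:
`inducedCMType`, `prod_norm_eq_prod_filter_comp`).

WHAT IS PROVED HERE (kernel, from the two tree files; no definition, nothing posited): for `L` a CM field Galois over
`ℚ`, `ι : L →+* ℂ`, a complex CM type `Φ` of `K` with base point `φ : K →ₐ[ℚ] L`, and ANY number field `M` that is an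
algebra over the reflex field `K* = reflexField ℚ L (algValuedIn ι Φ)`,

  `ι (φ (g (N_{M/K*} x))) = ∏_{θ ∈ Φ*_M} θ(x)`  (`x ∈ M`),

where `g = reflexNormHom ℚ L (algValuedIn ι Φ) φ : K* →* K` and `Φ*_M = inducedCMType (algebraMap K* M) (reflexCMType ι Φ φ)`
is the complex CM type of `M` induced from the complex reflex type `Φ*_ℂ = reflexCMType ι Φ φ` (`…ReflexCMType`).  The
identity needs NO compatibility between the algebra map `K* → M` and `ι`.

USE ([Liu2021] Y. Liu, *Fourier–Jacobi cycles and arithmetic relative trace formula*, Camb. J. Math. 9 (2021), Def. 4.5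
(1), TeX ll. 1939–1942: "we denote by `η'_μ` the reciprocity map, and put `η_μ := η'_μ ∘ Nm_{M_μ/M'_μ}`"): with `η'_μ`
DEFINED as Shimura's `g` for `(E, Φ_μ)` (base point `id`, `K = L = E`) and `M = M_μ ⊇ M'_μ = K*`, this file is the
product identity `ι₁(η_μ(x)) = ∏_{θ ∈ Ψ̃_μ} θ(x)` for the induced type `Ψ̃_μ = (Φ_μ*)_{M_μ}` — the `ReflexNormReading`
input of `Literature.AlgebraicGeometry.Liu2021.LiuCMData.cmType_eq_induced_of_det45` becomes a theorem for the defined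
reciprocity map (sub-object (N) of the cells' hCMisogE table).  Nothing about abelian varieties is used or claimed.

## References
* [Shimura1998] G. Shimura, *Abelian Varieties with Complex Multiplication and Modular Functions*, Princeton 1998,
  §8.3 Prop. 29, §18.5 (18.5b).
* [Streng2010] M. Streng, *Complex multiplication of abelian surfaces*, PhD thesis, Leiden 2010, Ch. I Def. 3.2, Lemma 3.3.
* [Liu2021] Y. Liu, Camb. J. Math. 9 (2021) 1–147 = arXiv:2102.11518, Def. 4.3 (2), Def. 4.5 (1).
-/

set_option autoImplicit false

namespace Literature.NumberTheory.ComplexMultiplication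

open Literature.AlgebraicGeometry.Motives (CMType)
open NumberField

section InducedReflexNorm

variable {L : Type*} [Field L] [NumberField L] [IsCMField L] [IsGalois ℚ L] {K : Type*} [Field K] [Algebra ℚ K]

/-- **Type norm of the induced reflex type = reflex type norm ∘ relative norm, in `ℂ`**: for any number field `M`
over the reflex field `K*`, `∏_{τ ∈ Φ*_ℂ} τ(N_{M/K*} x) = ∏_{θ ∈ Φ*_M} θ(x)`, where `Φ*_M = {θ : M → ℂ | θ|_{K*} ∈ Φ*_ℂ}`
is the induced type. [cite: Streng2010, Ch. I Def. 3.2 and Lemma 3.3] -/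
theorem finprod_reflexCMType_norm_eq_finprod_inducedCMType (ι : L →+* ℂ) (Φ : CMType K) (φ : K →ₐ[ℚ] L)
    {M : Type*} [Field M] [NumberField M] [Algebra (reflexField ℚ L (algValuedIn ι Φ.1)) M] (x : M) :
    ∏ᶠ τ ∈ (reflexCMType ι Φ φ).1, τ (Algebra.norm (reflexField ℚ L (algValuedIn ι Φ.1)) x) =
      ∏ᶠ θ ∈ (inducedCMType (algebraMap (reflexField ℚ L (algValuedIn ι Φ.1)) M) (reflexCMType ι Φ φ)).1,
        θ x := by
  classical
  have hS : ((reflexCMType ι Φ φ).1).Finite := Set.toFinite _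
  have hΘ : ((inducedCMType (algebraMap (reflexField ℚ L (algValuedIn ι Φ.1)) M) (reflexCMType ι Φ φ)).1).Finite :=
    Set.toFinite _
  rw [finprod_mem_eq_finite_toFinset_prod _ hS, finprod_mem_eq_finite_toFinset_prod _ hΘ,
    prod_norm_eq_prod_filter_comp hS.toFinset x]
  refine Finset.prod_congr ?_ fun _ _ => rfl
  ext θ
  simp only [Finset.mem_filter, Finset.mem_univ, true_and, Set.Finite.mem_toFinset, mem_inducedCMType_iff]

/-- **Shimura's reflex norm `g` followed by `N_{M/K*}`, read in `ℂ`, is the type norm of the induced reflex type**: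
`ι(φ(g(N_{M/K*} x))) = ∏_{θ ∈ Φ*_M} θ(x)` for every `x ∈ M`.  With `η' := g` (base point `id`) and `η := η' ∘ N_{M/K*}`
this is [Liu2021] Def. 4.5 (1)'s `η_μ` read through `ι₁`: `ι₁(η_μ(x)) = ∏_{θ ∈ Ψ̃_μ} θ(x)`.
[cite: Shimura1998, §18.5 (18.5b)] [cite: Streng2010, Ch. I Lemma 3.3] -/
theorem apply_reflexNormHom_norm_eq_finprod_inducedCMType (ι : L →+* ℂ) (Φ : CMType K) (φ : K →ₐ[ℚ] L)
    {M : Type*} [Field M] [NumberField M] [Algebra (reflexField ℚ L (algValuedIn ι Φ.1)) M] (x : M) :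
    ι (φ (reflexNormHom ℚ L (algValuedIn ι Φ.1) φ
        (Algebra.norm (reflexField ℚ L (algValuedIn ι Φ.1)) x))) =
      ∏ᶠ θ ∈ (inducedCMType (algebraMap (reflexField ℚ L (algValuedIn ι Φ.1)) M) (reflexCMType ι Φ φ)).1,
        θ x := by
  rw [comp_reflexNormHom_eq_finprod, finprod_reflexCMType_norm_eq_finprod_inducedCMType]

/-- Finite-enumeration form of `comp_reflexNormHom_eq_finprod` (the shape of the `ReflexNormReading` of
`Literature.AlgebraicGeometry.Liu2021.LiuCMData`, for the DEFINED reciprocity map `η' := g`): for any finset `S`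
enumerating the complex reflex type `Φ*_ℂ`, `ι(φ(g(α))) = ∏_{σ' ∈ S} σ'(α)`. [cite: Shimura1998, §18.5 (18.5b)] -/
theorem apply_reflexNormHom_eq_prod (ι : L →+* ℂ) (Φ : CMType K) (φ : K →ₐ[ℚ] L)
    {S : Finset (reflexField ℚ L (algValuedIn ι Φ.1) →+* ℂ)} (hS : (↑S : Set _) = (reflexCMType ι Φ φ).1)
    (α : reflexField ℚ L (algValuedIn ι Φ.1)) :
    ι (φ (reflexNormHom ℚ L (algValuedIn ι Φ.1) φ α)) = ∏ σ' ∈ S, σ' α := by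
  rw [comp_reflexNormHom_eq_finprod, ← hS, finprod_mem_coe_finset]

/-- Finite-enumeration form of `apply_reflexNormHom_norm_eq_finprod_inducedCMType`: for any finset `Θ` enumerating the
induced type `Φ*_M`, `ι(φ(g(N_{M/K*} x))) = ∏_{θ ∈ Θ} θ(x)` (the shape of a `LieEigenReading` product).
[cite: Shimura1998, §18.5 (18.5b)] [cite: Streng2010, Ch. I Lemma 3.3] -/
theorem apply_reflexNormHom_norm_eq_prod (ι : L →+* ℂ) (Φ : CMType K) (φ : K →ₐ[ℚ] L)
    {M : Type*} [Field M] [NumberField M] [Algebra (reflexField ℚ L (algValuedIn ι Φ.1)) M]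
    {Θ : Finset (M →+* ℂ)}
    (hΘ : (↑Θ : Set _) = (inducedCMType (algebraMap (reflexField ℚ L (algValuedIn ι Φ.1)) M) (reflexCMType ι Φ φ)).1)
    (x : M) :
    ι (φ (reflexNormHom ℚ L (algValuedIn ι Φ.1) φ
        (Algebra.norm (reflexField ℚ L (algValuedIn ι Φ.1)) x))) = ∏ θ ∈ Θ, θ x := by
  rw [apply_reflexNormHom_norm_eq_finprod_inducedCMType, ← hΘ, finprod_mem_coe_finset]

/-- **The induced reflex type is DETERMINED by the reciprocity map** (converse direction, by multiplicative independence
of embeddings, tree `set_eq_induced_of_finprod_eq`): a set `Θ` of complex embeddings of `M` whose product character is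
`x ↦ ι(φ(g(N_{M/K*} x)))` on `M ∖ {0}` IS the induced type `Φ*_M`.  This is the form in which [Liu2021] Def. 4.5 (2),
first bullet ("the determinant of the action of `i_μ(x)` on `Lie_E(A_μ)` equals `η_μ(x)`") pins down the CM type of
`A_μ ⊗_{E,ι₁} ℂ` as `Ψ̃_μ`. [cite: Streng2010, Ch. I Lemma 3.3] -/
theorem set_eq_inducedCMType_of_finprod_eq_apply_reflexNormHom_norm (ι : L →+* ℂ) (Φ : CMType K) (φ : K →ₐ[ℚ] L)
    {M : Type*} [Field M] [NumberField M] [Algebra (reflexField ℚ L (algValuedIn ι Φ.1)) M]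
    (Θ : Set (M →+* ℂ))
    (h : ∀ x : M, x ≠ 0 → ∏ᶠ θ ∈ Θ, θ x =
      ι (φ (reflexNormHom ℚ L (algValuedIn ι Φ.1) φ (Algebra.norm (reflexField ℚ L (algValuedIn ι Φ.1)) x)))) :
    Θ = (inducedCMType (algebraMap (reflexField ℚ L (algValuedIn ι Φ.1)) M) (reflexCMType ι Φ φ)).1 := by
  have h' : ∀ x : M, x ≠ 0 → ∏ᶠ θ ∈ Θ, θ x =
      ∏ᶠ σ' ∈ (reflexCMType ι Φ φ).1, σ' (Algebra.norm (reflexField ℚ L (algValuedIn ι Φ.1)) x) := fun x hx => by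
    rw [h x hx, comp_reflexNormHom_eq_finprod]
  rw [set_eq_induced_of_finprod_eq _ Θ h']
  ext θ
  simp only [Set.mem_setOf_eq, mem_inducedCMType_iff]

/-- **Explicit ring-homomorphism form** (the shape used at the cells' Liu pin, where the inclusion `e : K* → M` of the
reflex field into a bigger number field is produced as a ring homomorphism, e.g. `M'_μ ↪ M_μ`): with the algebra
structure `e.toAlgebra`, `ι(φ(g(N_{M/K*} x))) = ∏_{θ ∈ Φ*_M} θ(x)` where `Φ*_M = inducedCMType e Φ*_ℂ`.
[cite: Shimura1998, §18.5 (18.5b)] [cite: Streng2010, Ch. I Lemma 3.3] -/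
theorem apply_reflexNormHom_norm_eq_finprod_inducedCMType_of_ringHom (ι : L →+* ℂ) (Φ : CMType K)
    (φ : K →ₐ[ℚ] L) {M : Type*} [Field M] [NumberField M] (e : reflexField ℚ L (algValuedIn ι Φ.1) →+* M)
    (x : M) :
    letI := e.toAlgebra
    ι (φ (reflexNormHom ℚ L (algValuedIn ι Φ.1) φ
        (Algebra.norm (reflexField ℚ L (algValuedIn ι Φ.1)) x))) =
      ∏ᶠ θ ∈ (inducedCMType e (reflexCMType ι Φ φ)).1, θ x := by
  letI := e.toAlgebra
  exact apply_reflexNormHom_norm_eq_finprod_inducedCMType ι Φ φ x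

/-- **Base point `id` (the CM field is its own Galois closure)** — the form of [Liu2021] Def. 4.5 (1) for a Galois CM
field `E = L` with CM type `Θ = Φ_μ`, reflex field `M'_μ = K* ⊆ L`, DEFINED reciprocity map
`η'_μ := g = reflexNormHom ℚ L (algValuedIn ι Θ) id : K* →* L`, a number field `M = M_μ` receiving `e : K* →+* M`,
and `η_μ := η'_μ ∘ N_{M/K*}`: `ι(η_μ(x)) = ∏_{θ ∈ Ψ̃_μ} θ(x)` with `Ψ̃_μ = inducedCMType e (reflexCMType ι Θ id)`.
[cite: Liu2021, Def. 4.5 (1)] [cite: Shimura1998, §18.5 (18.5b)] [cite: Streng2010, Ch. I Lemma 3.3] -/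
theorem apply_reflexNormHom_id_norm_eq_finprod_inducedCMType (ι : L →+* ℂ) (Θ : CMType L)
    {M : Type*} [Field M] [NumberField M] (e : reflexField ℚ L (algValuedIn ι Θ.1) →+* M) (x : M) :
    letI := e.toAlgebra
    ι (reflexNormHom ℚ L (algValuedIn ι Θ.1) (AlgHom.id ℚ L)
        (Algebra.norm (reflexField ℚ L (algValuedIn ι Θ.1)) x)) =
      ∏ᶠ θ ∈ (inducedCMType e (reflexCMType ι Θ (AlgHom.id ℚ L))).1, θ x := by
  letI := e.toAlgebra
  exact apply_reflexNormHom_norm_eq_finprod_inducedCMType ι Θ (AlgHom.id ℚ L) x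

/-- Base point `id`, value of `η'_μ` itself: `ι(g(α)) = ∏_{τ ∈ Θ*_ℂ} τ(α)` for `α ∈ K*` (the `ReflexNormReading` of the
DEFINED reciprocity map, finprod currency). [cite: Shimura1998, §18.5 (18.5b)] -/
theorem apply_reflexNormHom_id_eq_finprod (ι : L →+* ℂ) (Θ : CMType L)
    (α : reflexField ℚ L (algValuedIn ι Θ.1)) :
    ι (reflexNormHom ℚ L (algValuedIn ι Θ.1) (AlgHom.id ℚ L) α) =
      ∏ᶠ τ ∈ (reflexCMType ι Θ (AlgHom.id ℚ L)).1, τ α :=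
  comp_reflexNormHom_eq_finprod ι Θ (AlgHom.id ℚ L) α

/-- Base point `id`, converse: a set `Θ'` of complex embeddings of `M` with product character
`x ↦ ι(g(N_{M/K*} x))` on `M ∖ {0}` is the induced type `inducedCMType e (reflexCMType ι Θ id)`.
[cite: Streng2010, Ch. I Lemma 3.3] -/
theorem set_eq_inducedCMType_of_finprod_eq_apply_reflexNormHom_id_norm (ι : L →+* ℂ) (Θ : CMType L)
    {M : Type*} [Field M] [NumberField M] (e : reflexField ℚ L (algValuedIn ι Θ.1) →+* M)
    (Θ' : Set (M →+* ℂ))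
    (h : letI := e.toAlgebra
      ∀ x : M, x ≠ 0 → ∏ᶠ θ ∈ Θ', θ x =
        ι (reflexNormHom ℚ L (algValuedIn ι Θ.1) (AlgHom.id ℚ L)
          (Algebra.norm (reflexField ℚ L (algValuedIn ι Θ.1)) x))) :
    Θ' = (inducedCMType e (reflexCMType ι Θ (AlgHom.id ℚ L))).1 := by
  letI := e.toAlgebra
  exact set_eq_inducedCMType_of_finprod_eq_apply_reflexNormHom_norm ι Θ (AlgHom.id ℚ L) Θ' h

end InducedReflexNorm

end Literature.NumberTheory.ComplexMultiplication
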